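import Mathlib
import Literature.Analysis.FluidPDE.NormalisedPressureDuality
import Literature.Analysis.FluidPDE.LerayHopf
import Summits.NavierStokesRegularity.NavierStokesRegularity.Theses.HiddenConvexityPressureFloor
import HarnessLib

/-!
# `HiddenConvexityPressureFloor.PressureFloorOfSemiconcave` — the floor lemma
  (item stmt-NavierStokesRegularity-2964)

**Statement.** Let `ν, T > 0` and let `(u, p)` be a classical solution of unforced Navier–Stokes on
`ℝ³ × [0, T)`, Leray–Hopf on `[0, T)` from its rapidly decaying datum `u 0`. If for some `K` every
slice of the normalised (Riesz-transform) pressure is `K`-semiconcave, i.e.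
`x ↦ p̃(t, x) − (K/2)‖x‖²` is concave for every `t ∈ [0, T)`, then `p̃` is bounded below on
`[0, T) × ℝ³`.

PROOF (the planner's sketch, with Jensen replaced by midpoint concavity against an even bump).
Fix the normalised bump `ψ = φ.normed` of a `ContDiffBump (0 : ℝ³)` with radii `1 < 2`
(smooth, compactly supported in `B(0, 2)`, even, `ψ ≥ 0`, `∫ ψ = 1`). For `t < T` and a centre
`x₀`, concavity of `q = p̃(t) − (K/2)‖·‖²` at the midpoint `x₀` of `x₀ ± z` and the parallelogram
law give `p̃(x₀ + z) + p̃(x₀ − z) ≤ 2 p̃(x₀) + K‖z‖²`; integrating against the even density `ψ`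
(the slice `p̃(t)` is continuous, being concave-plus-quadratic on `ℝ³`),
`∫ p̃(y) ψ(y − x₀) dy ≤ p̃(x₀) + (K/2)∫‖z‖²ψ ≤ p̃(x₀) + 2|K|`. The PROVED tree fact
`Literature.Analysis.FluidPDE.integral_normalisedPressure_mul_rescaled_le_holds` (Tao 2011, proof of
Lemma 4.1 (i)) bounds `|∫ p̃(y) ψ(y − x₀) dy| ≤ M ∫|u(t)|²` for the `C¹` finite-energy slice `u t`,
and the Leray–Hopf energy inequality (`IsLerayHopfOn.energy_ineq_zero`) bounds `∫|u(t)|² ≤ ∫|u(0)|²`.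
Hence `p̃(t, x₀) ≥ −(max M 0)·∫|u 0|² − 2|K|` uniformly.

HONEST FRAMING: an elementary convexity/duality estimate about HYPOTHETICAL solutions whose
pressure slices are assumed uniformly semiconcave; nothing here bears on whether that holds.
-/

noncomputable section

set_option linter.dupNamespace false

namespace Summit.NavierStokesRegularity.NavierStokesRegularity.Theorems

open Set MeasureTheory Filter Topology
open scoped ENNReal RealInnerProductSpace ContDiff
open Literature.Analysis.FluidPDE

/-- **Midpoint concavity with a quadratic correction**: if `x ↦ f x − (K/2)‖x‖²` is concave on a
real inner product space then `f (x₀ + z) + f (x₀ − z) ≤ 2 f x₀ + K ‖z‖²` (parallelogram law).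
[folklore] -/
theorem add_le_two_mul_add_of_concaveOn_sub_sq {E : Type*} [NormedAddCommGroup E]
    [InnerProductSpace ℝ E] {f : E → ℝ} {K : ℝ}
    (hf : ConcaveOn ℝ univ (fun x : E => f x - K / 2 * ‖x‖ ^ 2)) (x₀ z : E) :
    f (x₀ + z) + f (x₀ - z) ≤ 2 * f x₀ + K * ‖z‖ ^ 2 := by
  have hmid : (1 / 2 : ℝ) • (f (x₀ + z) - K / 2 * ‖x₀ + z‖ ^ 2)
      + (1 / 2 : ℝ) • (f (x₀ - z) - K / 2 * ‖x₀ - z‖ ^ 2)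
      ≤ f ((1 / 2 : ℝ) • (x₀ + z) + (1 / 2 : ℝ) • (x₀ - z))
        - K / 2 * ‖(1 / 2 : ℝ) • (x₀ + z) + (1 / 2 : ℝ) • (x₀ - z)‖ ^ 2 :=
    hf.2 (mem_univ (x₀ + z)) (mem_univ (x₀ - z)) (by norm_num) (by norm_num) (by norm_num)
  have hx : (1 / 2 : ℝ) • (x₀ + z) + (1 / 2 : ℝ) • (x₀ - z) = x₀ := by
    rw [← smul_add, add_add_sub_cancel, ← two_smul ℝ x₀, smul_smul]
    norm_num
  rw [hx] at hmid
  simp only [smul_eq_mul] at hmid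
  have hpar : ‖x₀ + z‖ ^ 2 + ‖x₀ - z‖ ^ 2 = 2 * ‖x₀‖ ^ 2 + 2 * ‖z‖ ^ 2 := by
    rw [norm_add_sq_real, norm_sub_sq_real]; ring
  have hparK : K * ‖x₀ + z‖ ^ 2 + K * ‖x₀ - z‖ ^ 2 = 2 * K * ‖x₀‖ ^ 2 + 2 * K * ‖z‖ ^ 2 := by
    rw [← mul_add, hpar]; ring
  linarith [hmid, hparK]

/-- **An even probability density turns midpoint concavity into a mean-value floor**: for
`f` continuous with `f (x₀ + z) + f (x₀ − z) ≤ 2 f x₀ + K‖z‖²` for all `z`, and `ψ ≥ 0` continuous,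
even, compactly supported in `‖z‖ ≤ r`, with `∫ ψ = 1`:
`∫ f (z + x₀) ψ z dz ≤ f x₀ + (|K| r² / 2)`. [folklore] -/
theorem integral_mul_le_of_midpoint {f ψ : EuclideanSpace ℝ (Fin 3) → ℝ} {K r : ℝ}
    {x₀ : EuclideanSpace ℝ (Fin 3)} (hf : Continuous f)
    (hmid : ∀ z, f (x₀ + z) + f (x₀ - z) ≤ 2 * f x₀ + K * ‖z‖ ^ 2)
    (hψc : Continuous ψ) (hψs : HasCompactSupport ψ) (hψ0 : ∀ z, 0 ≤ ψ z)
    (hψeven : ∀ z, ψ (-z) = ψ z) (hψr : ∀ z, ψ z ≠ 0 → ‖z‖ ≤ r) (hψ1 : ∫ z, ψ z = 1) :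
    ∫ z, f (z + x₀) * ψ z ≤ f x₀ + |K| * r ^ 2 / 2 := by
  -- integrability of the continuous, compactly supported integrands
  have hint : ∀ g : EuclideanSpace ℝ (Fin 3) → ℝ, Continuous g →
      Integrable (fun z => g z * ψ z) := fun g hg =>
    (hg.mul hψc).integrable_of_hasCompactSupport hψs.mul_left
  have h₁ : Integrable (fun z => f (z + x₀) * ψ z) := hint _ (hf.comp (continuous_id.add continuous_const))
  have h₂ : Integrable (fun z => f (x₀ - z) * ψ z) := hint _ (hf.comp (continuous_const.sub continuous_id))
  have h₃ : Integrable (fun z => (2 * f x₀ + K * ‖z‖ ^ 2) * ψ z) :=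
    hint _ (continuous_const.add (continuous_const.mul (continuous_norm.pow 2)))
  -- evenness: `∫ f (z + x₀) ψ z = ∫ f (x₀ - z) ψ z`
  have hsymm : ∫ z, f (z + x₀) * ψ z = ∫ z, f (x₀ - z) * ψ z := by
    rw [← integral_neg_eq_self (fun z => f (z + x₀) * ψ z)]
    refine integral_congr_ae (Eventually.of_forall fun z => ?_)
    simp only [hψeven, neg_add_eq_sub]
  -- pointwise midpoint bound, integrated
  have hle : ∫ z, (f (z + x₀) * ψ z + f (x₀ - z) * ψ z) ≤ ∫ z, (2 * f x₀ + K * ‖z‖ ^ 2) * ψ z := by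
    refine integral_mono (h₁.add h₂) h₃ fun z => ?_
    have h := hmid z
    rw [add_comm x₀ z] at h
    simp only
    rw [← add_mul]
    exact mul_le_mul_of_nonneg_right h (hψ0 z)
  rw [integral_add h₁ h₂, ← hsymm, ← two_mul] at hle
  -- evaluate the right-hand side
  have hsq : Integrable (fun z => ‖z‖ ^ 2 * ψ z) := hint _ (continuous_norm.pow 2)
  have hrhs : ∫ z, (2 * f x₀ + K * ‖z‖ ^ 2) * ψ z = 2 * f x₀ + K * ∫ z, ‖z‖ ^ 2 * ψ z := by
    have : (fun z => (2 * f x₀ + K * ‖z‖ ^ 2) * ψ z) =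
        fun z => (2 * f x₀) * ψ z + K * (‖z‖ ^ 2 * ψ z) := by
      funext z; ring
    rw [this, integral_add ((hint _ continuous_const)) (hsq.const_mul K), integral_const_mul,
      integral_const_mul, hψ1, mul_one]
  -- `0 ≤ ∫ ‖z‖² ψ ≤ r²`
  have hc0 : 0 ≤ ∫ z, ‖z‖ ^ 2 * ψ z := integral_nonneg fun z => mul_nonneg (sq_nonneg _) (hψ0 z)
  have hcr : ∫ z, ‖z‖ ^ 2 * ψ z ≤ r ^ 2 := by
    calc ∫ z, ‖z‖ ^ 2 * ψ z ≤ ∫ z, r ^ 2 * ψ z := by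
          refine integral_mono hsq ((hint _ continuous_const)) fun z => ?_
          by_cases hz : ψ z = 0
          · simp [hz]
          · exact mul_le_mul_of_nonneg_right
              (pow_le_pow_left₀ (norm_nonneg _) (hψr z hz) 2) (hψ0 z)
      _ = r ^ 2 := by rw [integral_const_mul, hψ1, mul_one]
  have hK : K * ∫ z, ‖z‖ ^ 2 * ψ z ≤ |K| * r ^ 2 := by
    calc K * ∫ z, ‖z‖ ^ 2 * ψ z ≤ |K| * ∫ z, ‖z‖ ^ 2 * ψ z :=
          mul_le_mul_of_nonneg_right (le_abs_self K) hc0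
      _ ≤ |K| * r ^ 2 := mul_le_mul_of_nonneg_left hcr (abs_nonneg K)
  rw [hrhs] at hle
  linarith

/-- **Item stmt-NavierStokesRegularity-2964** (`HiddenConvexityPressureFloor.PressureFloorOfSemiconcave`):
uniformly `K`-semiconcave normalised-pressure slices of a classical Leray–Hopf solution are
uniformly bounded below, with floor `−(max M 0)·∫|u 0|² − 2|K|` (`M` = Tao's duality constant of
the fixed bump). [this file] -/
theorem hiddenConvexityPressureFloor_pressureFloorOfSemiconcave_proof :
    Summit.NavierStokesRegularity.NavierStokesRegularity.Theses.HiddenConvexityPressureFloor.PressureFloorOfSemiconcave := by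
  unfold Summit.NavierStokesRegularity.NavierStokesRegularity.Theses.HiddenConvexityPressureFloor.PressureFloorOfSemiconcave
  intro ν T _hν _hT u p hcl hLH _hdec K hK
  -- the fixed even bump `ψ`, supported in `B(0, 2)`, `∫ ψ = 1`
  let φ : ContDiffBump (0 : EuclideanSpace ℝ (Fin 3)) := ⟨1, 2, one_pos, one_lt_two⟩
  set ψ : EuclideanSpace ℝ (Fin 3) → ℝ := φ.normed volume with hψdef
  have hψs : ContDiff ℝ ∞ ψ := φ.contDiff_normed
  have hψc : HasCompactSupport ψ := φ.hasCompactSupport_normed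
  have hψcont : Continuous ψ := φ.continuous_normed
  have hψ0 : ∀ z, 0 ≤ ψ z := fun z => φ.nonneg_normed z
  have hψeven : ∀ z, ψ (-z) = ψ z := fun z => φ.normed_neg z
  have hψ1 : ∫ z, ψ z = 1 := φ.integral_normed
  have hψr : ∀ z, ψ z ≠ 0 → ‖z‖ ≤ 2 := by
    intro z hz
    have hz' : z ∈ Function.support (φ.normed volume) := hz
    rw [φ.support_normed_eq] at hz'
    simpa using (Metric.mem_ball.1 hz').le
  -- Tao's duality constant for `ψ`
  obtain ⟨M, hM⟩ := integral_normalisedPressure_mul_rescaled_le_holds ψ hψs hψc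
  -- the energy budget
  obtain ⟨G, -, hE⟩ := hLH.energy_ineq_zero
  set E₀ : ℝ := 2 * VectorCalculus.kineticEnergy (u 0) with hE₀
  refine ⟨max M 0 * E₀ + 2 * |K|, fun t ht x₀ => ?_⟩
  have htc : t ∈ Icc 0 T := ⟨ht.1, ht.2.le⟩
  -- the slice: `C¹`, finite energy `≤ E₀`
  have hC1 : ContDiff ℝ 1 (u t) := (hcl.contDiff_velocity ht).of_le (by norm_cast)
  have heq : (∫⁻ x, ‖u t x‖ₑ ^ 2) = ENNReal.ofReal (2 * VectorCalculus.kineticEnergy (u t)) :=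
    hLH.eEnergy_eq htc
  have hfin : (∫⁻ x, ‖u t x‖ₑ ^ 2) < ⊤ := by rw [heq]; exact ENNReal.ofReal_lt_top
  have hkin : VectorCalculus.kineticEnergy (u t) ≤ VectorCalculus.kineticEnergy (u 0) := by
    have h := hE t htc
    have hz : ∫ τ in (0 : ℝ)..t, ∫ x, ⟪(0 : ℝ → EuclideanSpace ℝ (Fin 3) → EuclideanSpace ℝ (Fin 3))
        τ x, u τ x⟫ = 0 := by simp
    rw [hz, add_zero] at h
    have hν0 : 0 ≤ ν * (∫⁻ τ in Ioo 0 t, ∫⁻ x, ENNReal.ofReal (frobeniusNormSq (G τ x))).toReal :=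
      mul_nonneg _hν.le ENNReal.toReal_nonneg
    linarith
  have hEt : (∫⁻ x, ‖u t x‖ₑ ^ 2).toReal ≤ E₀ := by
    rw [heq, ENNReal.toReal_ofReal (mul_nonneg zero_le_two (kineticEnergy_nonneg (u t)))]
    linarith
  have hE₀0 : 0 ≤ E₀ := mul_nonneg zero_le_two (kineticEnergy_nonneg (u 0))
  -- Tao's bound at scale `R = 1`
  have hT1 := hM (u t) hC1 hfin x₀ 1 one_pos
  simp only [inv_one, one_smul] at hT1
  have hlow : -(max M 0 * E₀) ≤ ∫ x, normalisedPressure (u t) x * ψ (x - x₀) := by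
    have h1 : |∫ x, normalisedPressure (u t) x * ψ (x - x₀)| ≤ max M 0 * E₀ :=
      hT1.trans (mul_le_mul (le_max_left _ _) hEt ENNReal.toReal_nonneg (le_max_right _ _))
    linarith [neg_abs_le (∫ x, normalisedPressure (u t) x * ψ (x - x₀))]
  -- continuity of the slice `p̃(t)` (concave + quadratic on `ℝ³`)
  have hqc : Continuous fun x => normalisedPressure (u t) x - K / 2 * ‖x‖ ^ 2 :=
    continuousOn_univ.1 ((hK t ht).continuousOn isOpen_univ)
  have hpc : Continuous fun x => normalisedPressure (u t) x := by
    have h2 : Continuous fun x : EuclideanSpace ℝ (Fin 3) => K / 2 * ‖x‖ ^ 2 :=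
      continuous_const.mul (continuous_norm.pow 2)
    have h3 : (fun x => normalisedPressure (u t) x) =
        fun x => (normalisedPressure (u t) x - K / 2 * ‖x‖ ^ 2) + K / 2 * ‖x‖ ^ 2 := by
      funext x; ring
    rw [h3]
    exact hqc.add h2
  -- midpoint concavity integrated against `ψ(· - x₀)`
  have hmean : ∫ z, normalisedPressure (u t) (z + x₀) * ψ z ≤
      normalisedPressure (u t) x₀ + |K| * 2 ^ 2 / 2 :=
    integral_mul_le_of_midpoint hpc (add_le_two_mul_add_of_concaveOn_sub_sq (hK t ht) x₀)
      hψcont hψc hψ0 hψeven hψr hψ1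
  have hshift : ∫ z, normalisedPressure (u t) (z + x₀) * ψ z =
      ∫ x, normalisedPressure (u t) x * ψ (x - x₀) := by
    rw [← integral_add_right_eq_self (fun x => normalisedPressure (u t) x * ψ (x - x₀)) x₀]
    simp only [add_sub_cancel_right]
  rw [hshift] at hmean
  linarith

end Summit.NavierStokesRegularity.NavierStokesRegularity.Theorems

end
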